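import Literature.Barriers.ResolutionOfSingularities.AccessibleInDim
import HarnessLib

/-!
# Accessible over-rings in dimension `n`, decided for EVERY `n`: Zariski–Abhyankar accessibility
holds iff `n ≤ 2` (Sally 1972, Cor. 4.5 / Ex. 4.6 in all dimensions `n > 2`)

Topic: `Literature/Barriers/ResolutionOfSingularities` — reproduction of PUBLISHED work:
J. D. Sally, *Regular overrings of regular local rings*, Trans. Amer. Math. Soc. 171 (1972)
291–300 (Def. 4.1, Thm. 4.4, Cor. 4.5, Ex. 4.6), with D. L. Shannon, *Monoidal transforms of
regular local rings*, Amer. J. Math. 95 (1973) 294–320, written for the dimension-four obstruction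
census of the cell `pub-hironaka` (unit `b2b-hironaka-cp4`, `OBSTRUCTIONS-DIM4.md`, row O2b:
"Abhyankar's local factorization theorem one dimension up"). What is reproduced: Sally's
Corollary 4.5 — "Let `(R, M)` be an `n`-dimensional regular local ring, `n > 2`. Then `R` has
infinitely many regular local overrings which are not accessible from `R`" (p. 297) — in the form
needed to decide the census predicate `AccessibleInDim n` (`AccessibleInDim.lean`, [Sally1972,
Def. 4.1] verbatim) for every `n`, through her Example 4.6, which is printed for arbitrary
`n > 2`: "Let `(R, M)` be an `n`-dimensional regular local ring, `n > 2`, `M = (x, y, z, w₄, …, wₙ)`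
… `T = R[x/(y² + z³)]_N` … `T` is not accessible from `R`" (p. 297).

## Main results (everything PROVED; no named fact is introduced)

* `not_accessibleInDim_of_three_le : 3 ≤ n → ¬ AccessibleInDim n` — for every field `k` (the
  refutation uses `k = ℚ`) and `n = m + 3 ≥ 3`, with `K = k(t, y, z, w₄, …, wₙ)` and
  `x = t(y² + z³)`, the `n`-dimensional regular local ring `T = k[t,y,z,w]_{(t,y,z,w)}` of `K`
  birationally dominates `R = k[x,y,z,w]_{(x,y,z,w)}` and contains NO quotient `p/q` of two
  elements of `𝔪_R` linearly independent modulo `𝔪_R²` (`Sally1972AllDim.div_not_mem_Tn`, the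
  element-wise form of Thm. 4.4 for this `T`), hence no simple extension of `R` and no chain of
  simple extensions from `R` (`Sally1972AllDim.not_isStrictlyAccessible`).
* `accessibleInDim_of_le_one : n ≤ 1 → AccessibleInDim n` — the degenerate dimensions (a regular
  local ring of `K` of dimension `≤ 1` with `QF = K` is a valuation ring of `K`, so it is the only
  local ring of `K` dominating it). [folklore]
* `accessibleInDim_iff : AccessibleInDim n ↔ n ≤ 2` — with the tree's `accessibleInDim_two`
  (Zariski–Abhyankar [Abhyankar1956Valuations, Thm. 3] in Sally's language) the census row is a
  kernel statement in every dimension: factorization of a birational domination of `n`-dimensional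
  regular local rings into Sally's simple extensions (local quadratic / monoidal transforms whose
  centres are generated by part of a regular system of parameters) is available exactly in
  dimension `≤ 2`. For the census "dimension `≥ 4`" this is what bites in EVERY dimension `d ≥ 4`:
  the local rings at generic points of curves on a regular `d`-fold are `(d − 1)`-dimensional.

## Proof architecture (how dimension `n` is reduced to Sally's three variables)

The three-variable jet computation is the tree's `Sally1972.core`
(`LocalFactorizationFailsDimThree.lean`: for `a, b ∈ k[x,y,z]` vanishing at `0` with linearly
independent linear parts, `a(t f, y, z)·s ≠ b(t f, y, z)·g` whenever `s(0) ≠ 0`, `f = y² + z³`).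
Section `Core` proves the same statement in `m + 3` variables (`Sally1972AllDim.core`) by induction
on `m`: the substitution `w_last ↦ ℓ = Σ αᵢ Xᵢ` (`subst`, and `substT` on the `t`-side, compatible
with the chart: `substT_comp_chart`) maps a counter-identity in `m + 4` variables to one in `m + 3`
variables, acts on linear parts by the linear map `redV α` (`lin_subst`, first-order Taylor
expansion `taylor_mem_originIdeal_sq`), and `α` can always be chosen so that two independent
linear forms stay independent (`exists_redV_indepPair`: elementary linear algebra over any field,
using two distinct coordinates below the last one). Section `Rings` transports the polynomial
statement to the local rings exactly as in the three-variable file (`originLocalRing`,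
`mem_originLocalRing_iff`), proves `R ⊂ T` birational (`exists_div_eq_of_mem_Tn`), dominated
(`dominates`), `R ≠ T` (`v_zero_not_mem_Rn`, test point `(ε, 0, …, 0)`), both regular of dimension
`m + 3`. Sally's own proof of Thm. 4.4 goes through her Lemma 4.3 and the dimension formula for
`R ⊂ R[a/b]` [Davis]; as in the three-variable file the tree's route is the jet computation (the
tree's `Resolution/DimensionFormula.lean` covers the residually algebraic case only).

## Faithfulness remarks (referee R-O2b-1/2 of the cell apply verbatim)

The formal `T = k[t,y,z,w]_{(t,y,z,w)}` is the instance `N ∋ t` (`t = x/(y²+z³) ≡ 0`) of Thm. 4.4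
("`N` is any rank `n` maximal ideal of `R[a/b]`", `a = x ∉ M²`, `b = y² + z³ ∈ M²`, `(a, b)R`
prime); the printed Ex. 4.6 localises at the point where `(y² + z³)/x ≡ 1`. Both are instances of
the same theorem; one instance per `n` suffices to refute `AccessibleInDim n`. NOT reproduced:
"infinitely many" inaccessible over-rings (Cor. 4.5's family `T_i = R[x/f_i]_{N_i}`), Thm. 4.4 for an
arbitrary regular local ring `R` and arbitrary `(a, b)`, and Shannon's / Sally's accessible
over-ring `S ⊃ T` in dimension `n` (the tree has it for `n = 3`:
`InaccessibleIntermediateRing.lean`). The BARRIER block (D-0021: technique class, what it blocks,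
evasions, scope) is on `Sally1972_holds` in `LocalFactorizationFailsDimThree.lean`; with this file
its dimension clause reads "in every dimension `n ≥ 3`" instead of "in dimension three", the other
scope caveats unchanged.

## References

* [Sally1972] J. D. Sally, Regular overrings of regular local rings, Trans. AMS 171 (1972)
  291–300 — Def. 4.1 (p. 295), Thm. 4.4 (p. 296), Cor. 4.5 and Ex. 4.6 (p. 297).
* [Shannon1973] D. L. Shannon, Monoidal transforms of regular local rings, Amer. J. Math. 95
  (1973) 294–320.
* [Abhyankar1956Valuations] S. Abhyankar, On the valuations centered in a local domain,
  Amer. J. Math. 78 (1956) 321–348, Thm. 3.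
* [Cutkosky1999] S. D. Cutkosky, Local factorization and monomialization of morphisms,
  Astérisque 260 (1999), Ch. 1 p. 4 ("Sally [30] and Shannon [33] have found examples …").
-/

noncomputable section

open IsLocalRing

universe u v

namespace Literature.Barriers.ResolutionOfSingularities

open _root_.MvPolynomial Literature.AlgebraicGeometry.Resolution

namespace Sally1972AllDim

/-! ### Linear parts in `n` variables -/

section LinearParts

variable {k : Type u} [Field k] {n : ℕ}

/-- The linear coefficient of `Xᵢ` in `p ∈ k[X₀,…,X_{n-1}]`: `(∂p/∂Xᵢ)(0)`. [folklore] -/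
def lin (p : MvPolynomial (Fin n) k) (i : Fin n) : k := constantCoeff (pderiv i p)

/-- Constants have no linear part. [folklore] -/
@[simp] theorem lin_C (c : k) (i : Fin n) : lin (C c : MvPolynomial (Fin n) k) i = 0 := by simp [lin]

/-- `lin 0 = 0`. [folklore] -/
@[simp] theorem lin_zero (i : Fin n) : lin (0 : MvPolynomial (Fin n) k) i = 0 := by simp [lin]

/-- The linear part of a variable. [folklore] -/
@[simp] theorem lin_X (i j : Fin n) : lin (X j : MvPolynomial (Fin n) k) i = if j = i then 1 else 0 := by
  classical
  simp only [lin, pderiv_X, Pi.single_apply]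
  split_ifs with h <;> simp

/-- `lin` is additive. [folklore] -/
@[simp] theorem lin_add (p q : MvPolynomial (Fin n) k) (i : Fin n) :
    lin (p + q) i = lin p i + lin q i := by simp [lin]

/-- `lin` commutes with subtraction. [folklore] -/
@[simp] theorem lin_sub (p q : MvPolynomial (Fin n) k) (i : Fin n) :
    lin (p - q) i = lin p i - lin q i := by simp [lin]

/-- `lin` commutes with negation. [folklore] -/
@[simp] theorem lin_neg (p : MvPolynomial (Fin n) k) (i : Fin n) : lin (-p) i = -lin p i := by
  simp [lin]

/-- Product rule: `lin(pq) = p(0)·lin q + q(0)·lin p`. [folklore] -/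
theorem lin_mul (p q : MvPolynomial (Fin n) k) (i : Fin n) :
    lin (p * q) i = constantCoeff p * lin q i + constantCoeff q * lin p i := by
  simp only [lin, Derivation.leibniz, smul_eq_mul, map_add, map_mul]

/-- `lin (c·p) = c·lin p`. [folklore] -/
@[simp] theorem lin_C_mul (c : k) (p : MvPolynomial (Fin n) k) (i : Fin n) :
    lin (C c * p) i = c * lin p i := by
  simp [lin_mul]

/-- `lin` commutes with finite sums. [folklore] -/
@[simp] theorem lin_sum {ι : Type*} (s : Finset ι) (f : ι → MvPolynomial (Fin n) k) (i : Fin n) :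
    lin (∑ j ∈ s, f j) i = ∑ j ∈ s, lin (f j) i := by
  classical
  induction s using Finset.induction_on with
  | empty => simp
  | insert a s ha ih => rw [Finset.sum_insert ha, Finset.sum_insert ha, lin_add, ih]

/-- `lin (a − c·b) = lin a − c·lin b` as vectors. [folklore] -/
theorem lin_sub_C_mul_funext (a b : MvPolynomial (Fin n) k) (c : k) :
    lin (a - C c * b) = lin a - c • lin b := by
  funext i; simp

/-- A polynomial with vanishing constant and linear part lies in `(X)²`. [folklore] -/
theorem mem_originIdeal_sq {p : MvPolynomial (Fin n) k} (h0 : constantCoeff p = 0)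
    (h1 : ∀ i, lin p i = 0) : p ∈ originIdeal k n ^ 2 := by
  have hp : p ∈ Ideal.span (Set.range (X : Fin n → MvPolynomial (Fin n) k)) := by
    rw [← originIdeal_eq_span, mem_originIdeal_iff]; exact h0
  obtain ⟨c, hc⟩ := Ideal.mem_span_range_iff_exists_fun.mp hp
  have hci : ∀ j, constantCoeff (c j) = 0 := by
    intro j
    have := h1 j
    rw [← hc] at this
    simp only [lin, map_sum, Derivation.leibniz, pderiv_X, smul_eq_mul, map_add, map_mul,
      constantCoeff_X, zero_mul, add_zero] at this
    classical
    simp only [Pi.single_apply] at this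
    rw [Finset.sum_eq_single j] at this
    · simpa using this
    · intro b _ hb; simp [hb]
    · intro h; exact absurd (Finset.mem_univ j) h
  rw [← hc, sq]
  refine Ideal.sum_mem _ fun j _ => Ideal.mul_mem_mul ?_ ?_
  · exact (mem_originIdeal_iff k n).mpr (hci j)
  · rw [originIdeal_eq_span]; exact Ideal.subset_span ⟨j, rfl⟩

/-- The linear part vanishes on `(X)²`. [folklore] -/
theorem lin_eq_zero_of_mem_sq {p : MvPolynomial (Fin n) k} (hp : p ∈ originIdeal k n ^ 2)
    (i : Fin n) : lin p i = 0 := by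
  rw [sq] at hp
  refine Submodule.mul_induction_on hp (fun a ha b hb => ?_) (fun a b ha hb => ?_)
  · rw [lin_mul, (mem_originIdeal_iff k n).mp ha, (mem_originIdeal_iff k n).mp hb, zero_mul,
      zero_mul, add_zero]
  · rw [lin_add, ha, hb, add_zero]

/-- `(X)² ⊆ (X)`: elements of `(X)²` have no constant term. [folklore] -/
theorem constantCoeff_eq_zero_of_mem_sq {p : MvPolynomial (Fin n) k}
    (hp : p ∈ originIdeal k n ^ 2) : constantCoeff p = 0 :=
  (mem_originIdeal_iff k n).mp (Ideal.pow_le_self two_ne_zero hp)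

/-- First-order Taylor expansion at the origin: `p − p(0) − Σ lin p j · Xⱼ ∈ (X)²`. [folklore] -/
theorem taylor_mem_originIdeal_sq (p : MvPolynomial (Fin n) k) :
    p - C (constantCoeff p) - ∑ j, C (lin p j) * X j ∈ originIdeal k n ^ 2 := by
  refine mem_originIdeal_sq (by simp) fun i => ?_
  simp [Finset.sum_ite_eq']

/-! ### Evaluation at points without constant term -/

/-- `constantCoeff (p(θ)) = p(0)` when every `θⱼ` has zero constant term. [folklore] -/
theorem constantCoeff_aeval_eq {N : ℕ} (θ : Fin N → MvPolynomial (Fin n) k)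
    (hθ : ∀ j, constantCoeff (θ j) = 0) (p : MvPolynomial (Fin N) k) :
    constantCoeff (aeval θ p) = constantCoeff p := by
  have h1 : ∀ {M : ℕ} (q : MvPolynomial (Fin M) k), constantCoeff q = aeval (0 : Fin M → k) q :=
    fun q => by rw [aeval_zero]; rfl
  rw [h1, h1, ← AlgHom.comp_apply, MvPolynomial.comp_aeval]
  congr 1
  refine MvPolynomial.algHom_ext fun j => ?_
  rw [aeval_X, aeval_X, ← h1, hθ]; rfl

/-- `p(θ) ∈ (X)` maps `(X)^r` into `(X)^r` when every `θⱼ` has zero constant term. [folklore] -/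
theorem aeval_mem_originIdeal_pow {N : ℕ} (θ : Fin N → MvPolynomial (Fin n) k)
    (hθ : ∀ j, constantCoeff (θ j) = 0) {r : ℕ} {p : MvPolynomial (Fin N) k}
    (hp : p ∈ originIdeal k N ^ r) : aeval θ p ∈ originIdeal k n ^ r := by
  have hle : (originIdeal k N).map (aeval θ : MvPolynomial (Fin N) k →ₐ[k] MvPolynomial (Fin n) k) ≤
      originIdeal k n := by
    rw [originIdeal_eq_span, Ideal.map_span]
    refine Ideal.span_le.mpr ?_
    rintro _ ⟨_, ⟨j, rfl⟩, rfl⟩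
    simpa [mem_originIdeal_iff] using hθ j
  have h := Ideal.mem_map_of_mem (aeval θ : MvPolynomial (Fin N) k →ₐ[k] MvPolynomial (Fin n) k) hp
  rw [Ideal.map_pow] at h
  exact Ideal.pow_right_mono hle r h

/-- Chain rule for linear parts: `lin (p ∘ θ) i = Σⱼ lin p j · lin θⱼ i` when `θⱼ(0) = 0`.
[folklore] -/
theorem lin_aeval {N : ℕ} (θ : Fin N → MvPolynomial (Fin n) k)
    (hθ : ∀ j, constantCoeff (θ j) = 0) (p : MvPolynomial (Fin N) k) (i : Fin n) :
    lin (aeval θ p) i = ∑ j, lin p j * lin (θ j) i := by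
  have ht := taylor_mem_originIdeal_sq p
  have h2 : lin (aeval θ (p - C (constantCoeff p) - ∑ j, C (lin p j) * X j)) i = 0 :=
    lin_eq_zero_of_mem_sq (aeval_mem_originIdeal_pow θ hθ ht) i
  simp only [map_sub, map_sum, map_mul, algHom_C, aeval_X, lin_sub, lin_sum] at h2
  rw [MvPolynomial.algebraMap_eq, lin_C, sub_zero, sub_eq_zero] at h2
  rw [h2]
  refine Finset.sum_congr rfl fun j _ => ?_
  exact lin_C_mul _ _ _

end LinearParts

/-! ### Independent pairs of linear forms -/

section LinAlg

variable {k : Type u} [Field k] {ι : Type*}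

/-- `u, v : ι → k` are linearly independent (as a pair). [folklore] -/
def IndepPair (u v : ι → k) : Prop := ∀ c₁ c₂ : k, c₁ • u + c₂ • v = 0 → c₁ = 0 ∧ c₂ = 0

/-- Independence of a pair is symmetric. [folklore] -/
theorem IndepPair.symm {u v : ι → k} (h : IndepPair u v) : IndepPair v u :=
  fun c₁ c₂ hc => (h c₂ c₁ (by rw [add_comm]; exact hc)).symm

/-- `IndepPair u v` iff `v ≠ 0` and `u` is not a multiple of `v` (the form used by `Sally1972.core`).
[folklore] -/
theorem indepPair_iff {u v : ι → k} : IndepPair u v ↔ v ≠ 0 ∧ ∀ c : k, u ≠ c • v := by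
  constructor
  · intro h
    refine ⟨fun hv => ?_, fun c hc => ?_⟩
    · have := (h 0 1 (by rw [hv]; simp)).2
      exact one_ne_zero this
    · have := (h 1 (-c) (by rw [hc]; simp)).1
      exact one_ne_zero this
  · rintro ⟨hv, hc⟩ c₁ c₂ h
    have hc₁ : c₁ = 0 := by
      by_contra h₁
      apply hc (-(c₂ / c₁))
      funext i
      have hi := congrFun h i
      simp only [Pi.add_apply, Pi.smul_apply, smul_eq_mul, Pi.zero_apply] at hi
      simp only [Pi.smul_apply, smul_eq_mul]
      field_simp
      linear_combination hi
    refine ⟨hc₁, ?_⟩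
    rw [hc₁, zero_smul, zero_add] at h
    by_contra h₂
    apply hv
    funext i
    have hi := congrFun h i
    simp only [Pi.smul_apply, smul_eq_mul, Pi.zero_apply] at hi
    exact (mul_eq_zero.mp hi).resolve_left h₂

variable {N : ℕ}

/-- The linear map `k^{N+1} → k^N` induced on linear parts by the substitution
`X_last ↦ Σ αᵢ Xᵢ`. [folklore] -/
def redV (α : Fin N → k) (s : Fin (N + 1) → k) : Fin N → k :=
  fun i => s (Fin.castSucc i) + α i * s (Fin.last N)

/-- `redV α` is additive. [folklore] -/
theorem redV_add (α : Fin N → k) (s s' : Fin (N + 1) → k) :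
    redV α (s + s') = redV α s + redV α s' := by
  funext i; simp [redV]; ring

/-- `redV α` is homogeneous. [folklore] -/
theorem redV_smul (α : Fin N → k) (c : k) (s : Fin (N + 1) → k) :
    redV α (c • s) = c • redV α s := by
  funext i; simp [redV]; ring

/-- Key step: if `v_last ≠ 0`, some `α` makes `redV α` injective on `span(u, v)`; needs two
distinct indices below `last` (`N = M + 2`). [folklore] -/
theorem exists_redV_indepPair_of_ne {M : ℕ} (u v : Fin (M + 2 + 1) → k) (h : IndepPair u v)
    (hv : v (Fin.last _) ≠ 0) : ∃ α : Fin (M + 2) → k, IndepPair (redV α u) (redV α v) := by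
  set L := Fin.last (M + 2) with hL
  -- `u' = u - (u_L / v_L) v` has `u'_L = 0` and is nonzero
  set d : k := u L / v L with hd
  set u' : Fin (M + 2 + 1) → k := u - d • v with hu'
  have hu'L : u' L = 0 := by
    simp [hu', hd, div_mul_cancel₀ _ hv]
  have hu'ne : u' ≠ 0 := by
    intro h0
    have := (h 1 (-d) (by rw [one_smul, neg_smul, ← sub_eq_add_neg]; exact h0)).1
    exact one_ne_zero this
  -- an index `i₀` below `last` with `u' i₀ ≠ 0`
  obtain ⟨i₀, hi₀⟩ : ∃ i₀ : Fin (M + 2), u' (Fin.castSucc i₀) ≠ 0 := by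
    by_contra hcon
    push Not at hcon
    apply hu'ne
    funext j
    refine Fin.lastCases ?_ (fun i => ?_) j
    · exact hu'L
    · exact hcon i
  -- a second index `j₀ ≠ i₀`
  obtain ⟨j₀, hj₀⟩ : ∃ j₀ : Fin (M + 2), j₀ ≠ i₀ :=
    ⟨if i₀ = 0 then 1 else 0, by split_ifs with h0 <;> simp [h0, Ne.symm]⟩
  refine ⟨fun i => -(v (Fin.castSucc i) / v L) - (if i = j₀ then (v L)⁻¹ else 0), ?_⟩
  intro c₁ c₂ hc
  -- `w = c₁ u + c₂ v = c₁ u' + c₂' v`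
  set c₂' := c₂ + c₁ * d with hc₂'def
  have hw : c₁ • u + c₂ • v = c₁ • u' + c₂' • v := by
    rw [hu', hc₂'def, smul_sub, add_smul, smul_smul]; module
  have hk : ∀ i : Fin (M + 2), (c₁ • u' + c₂' • v) (Fin.castSucc i) +
      (-(v (Fin.castSucc i) / v L) - (if i = j₀ then (v L)⁻¹ else 0)) *
        (c₁ • u' + c₂' • v) L = 0 := by
    intro i
    have := congrFun hc i
    rw [Pi.add_apply, Pi.smul_apply, Pi.smul_apply, smul_eq_mul, smul_eq_mul, Pi.zero_apply] at this
    simp only [redV] at this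
    rw [← hL] at this
    have e1 : (c₁ • u' + c₂' • v) (Fin.castSucc i) = c₁ * u (Fin.castSucc i) + c₂ * v (Fin.castSucc i) := by
      have := congrFun hw (Fin.castSucc i)
      simp only [Pi.add_apply, Pi.smul_apply, smul_eq_mul] at this
      rw [this]; simp only [Pi.add_apply, Pi.smul_apply, smul_eq_mul]
    have e2 : (c₁ • u' + c₂' • v) L = c₁ * u L + c₂ * v L := by
      have := congrFun hw L
      simp only [Pi.add_apply, Pi.smul_apply, smul_eq_mul] at this
      rw [this]; simp only [Pi.add_apply, Pi.smul_apply, smul_eq_mul]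
    rw [e1, e2]
    linear_combination this
  -- evaluate: the `L`-coordinate of `w` is `c₂' v_L`
  have hwL : (c₁ • u' + c₂' • v) L = c₂' * v L := by
    simp [hu'L]
  -- at `i₀`: `c₁ u' i₀ = 0`, so `c₁ = 0`
  have h1 := hk i₀
  rw [if_neg (Ne.symm hj₀), hwL] at h1
  simp only [Pi.add_apply, Pi.smul_apply, smul_eq_mul, sub_zero] at h1
  have hc₁ : c₁ = 0 := by
    have : c₁ * u' (Fin.castSucc i₀) = 0 := by
      field_simp at h1
      linear_combination h1
    exact (mul_eq_zero.mp this).resolve_right hi₀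
  -- at `j₀`: `c₂' = 0`
  have h2 := hk j₀
  rw [if_pos rfl, hwL, hc₁] at h2
  simp only [zero_smul, zero_add, Pi.smul_apply, smul_eq_mul] at h2
  have hc₂'0 : c₂' = 0 := by
    field_simp at h2
    linear_combination -h2
  refine ⟨hc₁, ?_⟩
  calc c₂ = c₂' - c₁ * d := by rw [hc₂'def]; ring
    _ = 0 := by rw [hc₂'0, hc₁]; ring

/-- For an independent pair in `k^{M+3}` some substitution `X_last ↦ Σ αᵢ Xᵢ` keeps the linear
parts independent in `k^{M+2}`. [folklore] -/
theorem exists_redV_indepPair {M : ℕ} (u v : Fin (M + 2 + 1) → k) (h : IndepPair u v) :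
    ∃ α : Fin (M + 2) → k, IndepPair (redV α u) (redV α v) := by
  by_cases hv : v (Fin.last _) ≠ 0
  · exact exists_redV_indepPair_of_ne u v h hv
  by_cases hu : u (Fin.last _) ≠ 0
  · obtain ⟨α, hα⟩ := exists_redV_indepPair_of_ne v u h.symm hu
    exact ⟨α, hα.symm⟩
  · push Not at hu hv
    refine ⟨0, fun c₁ c₂ hc => h c₁ c₂ ?_⟩
    funext j
    refine Fin.lastCases ?_ (fun i => ?_) j
    · simp [hu, hv]
    · have := congrFun hc i
      simpa [redV] using this

end LinAlg

/-! ### The chart `x ↦ t(y² + z³)` in `m + 3` variables -/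

section Chart

variable (k : Type u) [Field k] (m : ℕ)

/-- The cusp `f = y² + z³` in `k[X₀, y, z, w₄, …]` (variables `1 ↦ y`, `2 ↦ z`).
[cite: Sally1972, Cor. 4.5 and Ex. 4.6] -/
def cusp : MvPolynomial (Fin (m + 3)) k := X 1 ^ 2 + X 2 ^ 3

/-- `f(0) = 0`. [folklore] -/
@[simp] theorem constantCoeff_cusp : constantCoeff (cusp k m) = 0 := by simp [cusp]

/-- The images of the variables under the chart: `x ↦ t·f`, all other variables fixed.
[cite: Sally1972, Ex. 4.6] -/
def chartFun (i : Fin (m + 3)) : MvPolynomial (Fin (m + 3)) k :=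
  if i = 0 then X 0 * cusp k m else X i

/-- The chart substitution `φ : k[x, y, z, w] → k[t, y, z, w]`, `x ↦ t·(y² + z³)` (the
`x/(y²+z³)`-chart of the blow-up along `x = y² + z³ = 0`), in `m + 3` variables.
[cite: Sally1972, Thm. 4.4 and Ex. 4.6] -/
def chart : MvPolynomial (Fin (m + 3)) k →ₐ[k] MvPolynomial (Fin (m + 3)) k :=
  aeval (chartFun k m)

/-- `φ(x) = t·f`. [cite: Sally1972, Ex. 4.6] -/
@[simp] theorem chart_X_zero : chart k m (X 0) = X 0 * cusp k m := by
  simp [chart, chartFun]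

/-- `φ` fixes every variable other than `x`. [cite: Sally1972, Ex. 4.6] -/
theorem chart_X_of_ne_zero {i : Fin (m + 3)} (hi : i ≠ 0) : chart k m (X i) = X i := by
  simp [chart, chartFun, hi]

/-- `1 ≠ 0` in `Fin (m + 3)` (bookkeeping). [folklore] -/
theorem one_ne_zero_fin : (1 : Fin (m + 3)) ≠ 0 := by
  simp

/-- `2 ≠ 0` in `Fin (m + 3)` (bookkeeping). [folklore] -/
theorem two_ne_zero_fin : (2 : Fin (m + 3)) ≠ 0 := by
  simp [Fin.ext_iff, Nat.mod_eq_of_lt (show 2 < m + 3 by omega)]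

/-- `1 ≠ 2` in `Fin (m + 3)` (bookkeeping). [folklore] -/
theorem one_ne_two_fin : (1 : Fin (m + 3)) ≠ 2 := by
  simp [Fin.ext_iff, Nat.mod_eq_of_lt (show 1 < m + 3 by omega),
    Nat.mod_eq_of_lt (show 2 < m + 3 by omega)]

/-- `f ≠ 0` (its `y²`-coefficient is `1`). [folklore] -/
theorem cusp_ne_zero : cusp k m ≠ 0 := by
  intro h
  have h1 : coeff (Finsupp.single 1 2) (cusp k m) = 1 := by
    rw [cusp, coeff_add, coeff_X_pow, coeff_X_pow, if_pos rfl, if_neg]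
    · simp
    · intro h'
      have := Finsupp.ext_iff.mp h' 2
      simp [one_ne_two_fin m] at this
  rw [h, coeff_zero] at h1
  exact zero_ne_one h1

/-- `φ(y) = y`. [cite: Sally1972, Ex. 4.6] -/
@[simp] theorem chart_X_one : chart k m (X 1) = X 1 := chart_X_of_ne_zero k m (one_ne_zero_fin m)

/-- `φ(z) = z`. [cite: Sally1972, Ex. 4.6] -/
@[simp] theorem chart_X_two : chart k m (X 2) = X 2 := chart_X_of_ne_zero k m (two_ne_zero_fin m)

/-- `φ(f) = f`. [folklore] -/
@[simp] theorem chart_cusp : chart k m (cusp k m) = cusp k m := by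
  simp [cusp, map_add, map_pow]

/-- The images of the variables under `φ` have no constant term. [folklore] -/
theorem constantCoeff_chartFun (i : Fin (m + 3)) : constantCoeff (chartFun k m i) = 0 := by
  unfold chartFun
  split_ifs <;> simp

/-- `φ` preserves constant coefficients. [folklore] -/
theorem constantCoeff_chart (p : MvPolynomial (Fin (m + 3)) k) :
    constantCoeff (chart k m p) = constantCoeff p :=
  constantCoeff_aeval_eq _ (constantCoeff_chartFun k m) p

/-- Evaluating through the chart. [folklore] -/
theorem aeval_chart {D : Type*} [CommRing D] [Algebra k D] (θ : Fin (m + 3) → D)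
    (p : MvPolynomial (Fin (m + 3)) k) :
    aeval θ (chart k m p) = aeval (fun i => aeval θ (chartFun k m i)) p := by
  rw [chart, ← AlgHom.comp_apply, MvPolynomial.comp_aeval]

/-- `φ` is injective (birationality of the blow-up chart: after inverting `f` it becomes an
isomorphism). [folklore] -/
theorem chart_injective : Function.Injective (chart k m) := by
  set Lf := Localization.Away (cusp k m)
  have hF : algebraMap (MvPolynomial (Fin (m + 3)) k) Lf (cusp k m) *
      IsLocalization.Away.invSelf (cusp k m) = 1 :=
    IsLocalization.Away.mul_invSelf (cusp k m)
  let ψ : MvPolynomial (Fin (m + 3)) k →ₐ[k] Lf :=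
    aeval fun i => if i = 0 then algebraMap (MvPolynomial (Fin (m + 3)) k) Lf (X 0) *
      IsLocalization.Away.invSelf (cusp k m) else algebraMap (MvPolynomial (Fin (m + 3)) k) Lf (X i)
  have hψ0 : ψ (X 0) = algebraMap (MvPolynomial (Fin (m + 3)) k) Lf (X 0) *
      IsLocalization.Away.invSelf (cusp k m) := by simp [ψ]
  have hψi : ∀ {i : Fin (m + 3)}, i ≠ 0 →
      ψ (X i) = algebraMap (MvPolynomial (Fin (m + 3)) k) Lf (X i) := by
    intro i hi; simp [ψ, hi]
  have hψf : ψ (cusp k m) = algebraMap (MvPolynomial (Fin (m + 3)) k) Lf (cusp k m) := by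
    change ψ (X 1 ^ 2 + X 2 ^ 3) = algebraMap _ _ (X 1 ^ 2 + X 2 ^ 3)
    rw [map_add, map_pow, map_pow, hψi (one_ne_zero_fin m), hψi (two_ne_zero_fin m), map_add,
      map_pow, map_pow]
  have hcomp : ψ.comp (chart k m) = IsScalarTower.toAlgHom k (MvPolynomial (Fin (m + 3)) k) Lf := by
    refine algHom_ext fun i => ?_
    by_cases hi : i = 0
    · subst hi
      change ψ (chart k m (X 0)) = algebraMap _ _ (X 0)
      rw [chart_X_zero, map_mul, hψf, hψ0, mul_assoc, mul_comm (IsLocalization.Away.invSelf _), hF,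
        mul_one]
    · change ψ (chart k m (X i)) = algebraMap _ _ (X i)
      rw [chart_X_of_ne_zero k m hi, hψi hi]
  have hinj : Function.Injective (algebraMap (MvPolynomial (Fin (m + 3)) k) Lf) :=
    IsLocalization.injective Lf (powers_le_nonZeroDivisors_of_noZeroDivisors (cusp_ne_zero k m))
  intro a b hab
  apply hinj
  have := congrArg ψ hab
  rwa [← AlgHom.comp_apply, ← AlgHom.comp_apply, hcomp] at this

end Chart

/-! ### The one-variable reduction `m + 4 ↦ m + 3` -/

section Reduction

variable {k : Type u} [Field k] {m : ℕ}

/-- Killing the last variable on the `R`-side: `X_last ↦ ℓ(x, y, z, w)`, the other variables fixed.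
[folklore] -/
def subst (ℓ : MvPolynomial (Fin (m + 3)) k) :
    MvPolynomial (Fin (m + 3 + 1)) k →ₐ[k] MvPolynomial (Fin (m + 3)) k :=
  aeval (Fin.snoc X ℓ)

/-- Killing the last variable on the `T`-side, compatibly: `X_last ↦ φ(ℓ)`. [folklore] -/
def substT (ℓ : MvPolynomial (Fin (m + 3)) k) :
    MvPolynomial (Fin (m + 3 + 1)) k →ₐ[k] MvPolynomial (Fin (m + 3)) k :=
  aeval (Fin.snoc X (chart k m ℓ))

/-- `subst` fixes the first `m + 3` variables. [folklore] -/
@[simp] theorem subst_X_castSucc (ℓ : MvPolynomial (Fin (m + 3)) k) (i : Fin (m + 3)) :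
    subst ℓ (X (Fin.castSucc i)) = X i := by
  simp [subst]

/-- `subst` sends the last variable to `ℓ`. [folklore] -/
@[simp] theorem subst_X_last (ℓ : MvPolynomial (Fin (m + 3)) k) :
    subst ℓ (X (Fin.last _)) = ℓ := by
  simp [subst]

/-- `substT` fixes the first `m + 3` variables. [folklore] -/
@[simp] theorem substT_X_castSucc (ℓ : MvPolynomial (Fin (m + 3)) k) (i : Fin (m + 3)) :
    substT ℓ (X (Fin.castSucc i)) = X i := by
  simp [substT]

/-- `substT` sends the last variable to `φ(ℓ)`. [folklore] -/
@[simp] theorem substT_X_last (ℓ : MvPolynomial (Fin (m + 3)) k) :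
    substT ℓ (X (Fin.last _)) = chart k m ℓ := by
  simp [substT]

/-- `castSucc 0 = 0` (bookkeeping). [folklore] -/
theorem castSucc_zero' : (Fin.castSucc (0 : Fin (m + 3)) : Fin (m + 3 + 1)) = 0 := rfl

/-- `castSucc 1 = 1` (bookkeeping). [folklore] -/
theorem castSucc_one' : (Fin.castSucc (1 : Fin (m + 3)) : Fin (m + 3 + 1)) = 1 := by
  apply Fin.ext; simp

/-- `castSucc 2 = 2` (bookkeeping). [folklore] -/
theorem castSucc_two' : (Fin.castSucc (2 : Fin (m + 3)) : Fin (m + 3 + 1)) = 2 := by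
  apply Fin.ext
  simp [Nat.mod_eq_of_lt (show 2 < m + 3 by omega), Nat.mod_eq_of_lt (show 2 < m + 3 + 1 by omega)]

/-- `last ≠ 0` (bookkeeping). [folklore] -/
theorem last_ne_zero' : (Fin.last (m + 3) : Fin (m + 3 + 1)) ≠ 0 := by
  simp [Fin.ext_iff]

/-- `substT (f_{m+4}) = f_{m+3}` for the cusp. [folklore] -/
theorem substT_cusp (ℓ : MvPolynomial (Fin (m + 3)) k) :
    substT ℓ (cusp k (m + 1)) = cusp k m := by
  rw [cusp, cusp, map_add, map_pow, map_pow, ← castSucc_one', ← castSucc_two', substT_X_castSucc,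
    substT_X_castSucc]

/-- `subst (f_{m+4}) = f_{m+3}` for the cusp. [folklore] -/
theorem subst_cusp (ℓ : MvPolynomial (Fin (m + 3)) k) :
    subst ℓ (cusp k (m + 1)) = cusp k m := by
  rw [cusp, cusp, map_add, map_pow, map_pow, ← castSucc_one', ← castSucc_two', subst_X_castSucc,
    subst_X_castSucc]

/-- **Compatibility of the reduction with the chart**: `substT ∘ φ_{m+4} = φ_{m+3} ∘ subst`.
[folklore] -/
theorem substT_comp_chart (ℓ : MvPolynomial (Fin (m + 3)) k) :
    (substT ℓ).comp (chart k (m + 1)) = (chart k m).comp (subst ℓ) := by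
  refine algHom_ext fun j => ?_
  rw [AlgHom.comp_apply, AlgHom.comp_apply]
  induction j using Fin.lastCases with
  | last =>
    rw [chart_X_of_ne_zero k (m + 1) last_ne_zero', substT_X_last, subst_X_last]
  | cast i =>
    by_cases hi : i = 0
    · subst hi
      rw [castSucc_zero', chart_X_zero, map_mul, substT_cusp, ← castSucc_zero', substT_X_castSucc,
        subst_X_castSucc, chart_X_zero]
    · have hi' : (Fin.castSucc i : Fin (m + 3 + 1)) ≠ 0 := fun h => hi (by
        rw [← castSucc_zero'] at h; exact Fin.castSucc_injective _ h)
      rw [chart_X_of_ne_zero k (m + 1) hi', substT_X_castSucc, subst_X_castSucc,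
        chart_X_of_ne_zero k m hi]

/-- Pointwise form of `substT_comp_chart`. [folklore] -/
theorem substT_chart (ℓ : MvPolynomial (Fin (m + 3)) k) (p : MvPolynomial (Fin (m + 3 + 1)) k) :
    substT ℓ (chart k (m + 1) p) = chart k m (subst ℓ p) := by
  rw [← AlgHom.comp_apply, substT_comp_chart, AlgHom.comp_apply]

/-- The images of the variables under `subst` have no constant term. [folklore] -/
theorem constantCoeff_snoc_X {ℓ : MvPolynomial (Fin (m + 3)) k} (hℓ : constantCoeff ℓ = 0)
    (j : Fin (m + 3 + 1)) :
    constantCoeff ((Fin.snoc X ℓ : Fin (m + 3 + 1) → MvPolynomial (Fin (m + 3)) k) j) = 0 := by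
  induction j using Fin.lastCases with
  | last => rw [Fin.snoc_last]; exact hℓ
  | cast i => rw [Fin.snoc_castSucc]; exact constantCoeff_X k i

/-- `subst` preserves constant coefficients. [folklore] -/
theorem constantCoeff_subst {ℓ : MvPolynomial (Fin (m + 3)) k} (hℓ : constantCoeff ℓ = 0)
    (p : MvPolynomial (Fin (m + 3 + 1)) k) : constantCoeff (subst ℓ p) = constantCoeff p :=
  constantCoeff_aeval_eq _ (constantCoeff_snoc_X hℓ) p

/-- `substT` preserves constant coefficients. [folklore] -/
theorem constantCoeff_substT {ℓ : MvPolynomial (Fin (m + 3)) k} (hℓ : constantCoeff ℓ = 0)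
    (p : MvPolynomial (Fin (m + 3 + 1)) k) : constantCoeff (substT ℓ p) = constantCoeff p := by
  refine constantCoeff_aeval_eq _ (fun j => ?_) p
  induction j using Fin.lastCases with
  | last => rw [Fin.snoc_last, constantCoeff_chart]; exact hℓ
  | cast i => rw [Fin.snoc_castSucc]; exact constantCoeff_X k i

/-- **Linear parts under the reduction**: `lin (subst_ℓ f) = redV (lin ℓ) (lin f)`. [folklore] -/
theorem lin_subst {ℓ : MvPolynomial (Fin (m + 3)) k} (hℓ : constantCoeff ℓ = 0)
    (f : MvPolynomial (Fin (m + 3 + 1)) k) : lin (subst ℓ f) = redV (lin ℓ) (lin f) := by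
  funext i
  rw [subst, lin_aeval _ (constantCoeff_snoc_X hℓ), Fin.sum_univ_castSucc, Fin.snoc_last, redV]
  simp only [Fin.snoc_castSucc, lin_X, mul_ite, mul_one, mul_zero, Finset.sum_ite_eq',
    Finset.mem_univ, if_true]
  ring

/-- The linear form `ℓ_α = Σ αᵢ Xᵢ`. [folklore] -/
def linForm (α : Fin (m + 3) → k) : MvPolynomial (Fin (m + 3)) k := ∑ i, C (α i) * X i

/-- `ℓ_α(0) = 0`. [folklore] -/
@[simp] theorem constantCoeff_linForm (α : Fin (m + 3) → k) : constantCoeff (linForm α) = 0 := by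
  simp [linForm]

/-- `lin ℓ_α = α`. [folklore] -/
@[simp] theorem lin_linForm (α : Fin (m + 3) → k) : lin (linForm α) = α := by
  funext i
  simp [linForm, Finset.sum_ite_eq']

end Reduction

/-! ### Sally's polynomial core in every dimension `≥ 3` -/

section Core

variable {k : Type u} [Field k]

/-- In three variables the chart is the one of `LocalFactorizationFailsDimThree`. [folklore] -/
theorem chart_zero_eq : chart k 0 = Sally1972.chart k := by
  refine algHom_ext fun i => ?_
  fin_cases i <;> simp [chart, chartFun, cusp, Sally1972.chart, Sally1972.cusp]

/-- **Core, all dimensions**: if `a(0) = b(0) = 0` and the linear parts of `a, b ∈ k[x,y,z,w]`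
(`m + 3` variables) are linearly independent, then `a(x,…)·s ≠ b(x,…)·g` in `k[t,y,z,w]`
(`x = t(y²+z³)`) whenever `s(0) ≠ 0`. Induction on `m`: the case `m = 0` is `Sally1972.core`
(the jet computation in three variables); the inductive step substitutes `X_last ↦ Σ αᵢ Xᵢ` with
`α` chosen so that the linear parts stay independent (`exists_redV_indepPair`).
[cite: Sally1972, Thm. 4.4, Cor. 4.5] -/
theorem core : ∀ (m : ℕ) {a b g s : MvPolynomial (Fin (m + 3)) k},
    constantCoeff a = 0 → constantCoeff b = 0 → IndepPair (lin a) (lin b) →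
    constantCoeff s ≠ 0 → chart k m a * s ≠ chart k m b * g
  | 0, a, b, g, s, ha0, hb0, hab, hs => by
    obtain ⟨H1, H2⟩ := indepPair_iff.mp hab
    rw [chart_zero_eq]
    exact Sally1972.core ha0 hb0 H1 H2 hs
  | m + 1, a, b, g, s, ha0, hb0, hab, hs => by
    obtain ⟨α, hα⟩ := exists_redV_indepPair (lin a) (lin b) hab
    intro he
    have he' := congrArg (substT (linForm α)) he
    rw [map_mul, map_mul, substT_chart, substT_chart] at he'
    refine core m (a := subst (linForm α) a) (b := subst (linForm α) b)
      (g := substT (linForm α) g) (s := substT (linForm α) s) ?_ ?_ ?_ ?_ he'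
    · rw [constantCoeff_subst (constantCoeff_linForm α)]; exact ha0
    · rw [constantCoeff_subst (constantCoeff_linForm α)]; exact hb0
    · rw [lin_subst (constantCoeff_linForm α), lin_subst (constantCoeff_linForm α), lin_linForm]
      exact hα
    · rw [constantCoeff_substT (constantCoeff_linForm α)]; exact hs

end Core

/-! ### The rings `R = k[x,y,z,w]_{(x,y,z,w)} ⊂ T = k[t,y,z,w]_{(t,y,z,w)}` in dimension `m + 3` -/

section Rings

open _root_.TrivSqZeroExt

variable {k : Type u} [Field k] {L : Type v} [Field L] [Algebra k L] {m : ℕ}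
  {v : Fin (m + 3) → L}

/-- The point `(x, y, z, w₄, …) = (t·(y² + z³), y, z, w₄, …)` of `L^{m+3}` attached to
`v = (t, y, z, w₄, …)`. [cite: Sally1972, Ex. 4.6] -/
def pt (k : Type u) [Field k] [Algebra k L] (m : ℕ) (v : Fin (m + 3) → L) : Fin (m + 3) → L :=
  fun i => aeval v (chartFun k m i)

/-- `x = t(y² + z³)`. [cite: Sally1972, Ex. 4.6] -/
theorem pt_zero : pt k m v 0 = v 0 * (v 1 ^ 2 + v 2 ^ 3) := by
  simp [pt, chartFun, cusp, map_add, map_pow]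

/-- The other coordinates of the point are `y, z, w₄, …`. [cite: Sally1972, Ex. 4.6] -/
theorem pt_of_ne_zero {i : Fin (m + 3)} (hi : i ≠ 0) : pt k m v i = v i := by
  simp [pt, chartFun, hi]

/-- `p(x, y, z, w) = (φ p)(t, y, z, w)`. [folklore] -/
theorem aeval_pt (p : MvPolynomial (Fin (m + 3)) k) : aeval (pt k m v) p = aeval v (chart k m p) := by
  rw [aeval_chart]; rfl

/-- `f(v) = y² + z³`. [folklore] -/
theorem aeval_cusp : aeval v (cusp k m) = v 1 ^ 2 + v 2 ^ 3 := by
  simp [cusp, map_add, map_pow]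

variable (hv : AlgebraicIndependent k v)
include hv

/-- `(x, y, z, w)` is algebraically independent (the chart is injective). [folklore] -/
theorem algebraicIndependent_pt : AlgebraicIndependent k (pt k m v) := by
  rw [algebraicIndependent_iff_injective_aeval]
  intro p q hpq
  rw [aeval_pt, aeval_pt] at hpq
  exact chart_injective k m (algebraicIndependent_iff_injective_aeval.mp hv hpq)

/-- **`R = k[x, y, z, w₄, …, wₙ]_{(x,y,z,w)} ⊆ L`**, `x = t(y² + z³)`: Sally's `(R, M)`,
`M = (x, y, z, w₄, …, wₙ)`, `n = m + 3`. [cite: Sally1972, Ex. 4.6] -/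
abbrev Rn : Subalgebra k L := originLocalRing (algebraicIndependent_pt hv)

/-- **`T = k[t, y, z, w₄, …, wₙ]_{(t,y,z,w)} ⊆ L`**, `t = x/(y² + z³)` — Sally's `T = R[x/(y²+z³)]_N`
at the rank-`n` maximal ideal `N ∋ t`. [cite: Sally1972, Thm. 4.4 and Ex. 4.6] -/
abbrev Tn : Subalgebra k L := originLocalRing hv

/-- `R` is local. [folklore] -/
instance : IsLocalRing (Rn hv) := isLocalRing_originLocalRing _

/-- `T` is local. [folklore] -/
instance : IsLocalRing (Tn hv) := isLocalRing_originLocalRing _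

/-- `R` is a regular local ring. [folklore] -/
theorem isRegularLocalRing_Rn : IsRegularLocalRing (Rn hv) := isRegularLocalRing_originLocalRing _

/-- `T` is a regular local ring. [folklore] -/
theorem isRegularLocalRing_Tn : IsRegularLocalRing (Tn hv) := isRegularLocalRing_originLocalRing _

/-- `dim R = m + 3`. [folklore] -/
theorem ringKrullDim_Rn : ringKrullDim (Rn hv) = (m + 3 : ℕ) := ringKrullDim_originLocalRing _

/-- `dim T = m + 3`. [folklore] -/
theorem ringKrullDim_Tn : ringKrullDim (Tn hv) = (m + 3 : ℕ) := ringKrullDim_originLocalRing _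

/-- `x, y, z, w ∈ T`. [folklore] -/
theorem pt_mem_Tn (i : Fin (m + 3)) : pt k m v i ∈ Tn hv :=
  aeval_mem_originLocalRing hv _

/-- `x, y, z, w ∈ 𝔪_T`. [folklore] -/
theorem pt_mem_maximalIdeal_Tn (i : Fin (m + 3)) :
    (⟨pt k m v i, pt_mem_Tn hv i⟩ : Tn hv) ∈ maximalIdeal (Tn hv) :=
  Sally1972.aeval_mem_maximalIdeal hv (constantCoeff_chartFun k m i)

/-- `R ⊆ T`. [cite: Sally1972, Ex. 4.6] -/
theorem Rn_le_Tn : Rn hv ≤ Tn hv :=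
  originLocalRing_le_of_forall_mem_maximalIdeal _ hv (pt_mem_Tn hv) (pt_mem_maximalIdeal_Tn hv)

/-- **`T` dominates `R`**. [cite: Sally1972, Thm. 4.4] -/
theorem dominates : SubringDominates (Rn hv).toSubring (Tn hv).toSubring :=
  ⟨Rn_le_Tn hv, fun _ hq hinv =>
    inv_mem_originLocalRing_of_forall_mem_maximalIdeal _ hv (pt_mem_Tn hv)
      (pt_mem_maximalIdeal_Tn hv) hq hinv⟩

omit hv in
/-- `p(w) ∈ Iʳ` when all `wᵢ ∈ I` and `p ∈ (X)ʳ`. [folklore] -/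
theorem aeval_mem_pow' {D : Type*} [CommRing D] [Algebra k D] {n : ℕ} {θ : Fin n → D}
    {I : Ideal D} (hθ : ∀ i, θ i ∈ I) {r : ℕ} {p : MvPolynomial (Fin n) k}
    (hp : p ∈ originIdeal k n ^ r) : aeval θ p ∈ I ^ r := by
  have hle : (originIdeal k n).map (aeval θ : MvPolynomial (Fin n) k →ₐ[k] D) ≤ I := by
    rw [originIdeal_eq_span, Ideal.map_span]
    refine Ideal.span_le.mpr ?_
    rintro _ ⟨_, ⟨i, rfl⟩, rfl⟩
    simpa using hθ i
  have h := Ideal.mem_map_of_mem (aeval θ : MvPolynomial (Fin n) k →ₐ[k] D) hp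
  rw [Ideal.map_pow] at h
  exact Ideal.pow_right_mono hle r h

omit hv in
/-- A fraction `p(w)/d(w)` with `p ∈ (X)²` and `d(0) ≠ 0` lies in `𝔪²` of `k[w]_{(w)}`. [folklore] -/
theorem div_mem_maximalIdeal_sq {n : ℕ} {w : Fin n → L} (hw : AlgebraicIndependent k w)
    {p d : MvPolynomial (Fin n) k} (hp : p ∈ originIdeal k n ^ 2) (hd : constantCoeff d ≠ 0) :
    (haveI := isLocalRing_originLocalRing hw;
      (⟨aeval w p / aeval w d, (mem_originLocalRing_iff hw).mpr ⟨p, d, hd, rfl⟩⟩ :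
        originLocalRing hw) ∈ maximalIdeal (originLocalRing hw) ^ 2) := by
  haveI := isLocalRing_originLocalRing hw
  have hmax : ∀ i, originCoord hw i ∈ maximalIdeal (originLocalRing hw) := fun i => by
    rw [maximalIdeal_originLocalRing]; exact Ideal.subset_span ⟨i, rfl⟩
  obtain ⟨u, hu⟩ := isUnit_aeval_of_constantCoeff_ne_zero (originCoord hw) hmax hd
  have hmem : aeval (originCoord hw) p ∈ maximalIdeal (originLocalRing hw) ^ 2 :=
    aeval_mem_pow' hmax hp
  have key : (⟨aeval w p / aeval w d, (mem_originLocalRing_iff hw).mpr ⟨p, d, hd, rfl⟩⟩ :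
      originLocalRing hw) = aeval (originCoord hw) p * ↑u⁻¹ := by
    apply Subtype.ext
    change aeval w p / aeval w d = ((aeval (originCoord hw) p * ↑u⁻¹ : originLocalRing hw) : L)
    rw [Subalgebra.coe_mul, coe_units_inv_subalgebra, hu, coe_aeval_subalgebra,
      coe_aeval_subalgebra, div_eq_mul_inv]
    rfl
  rw [key]
  exact Ideal.mul_mem_right _ _ hmem

/-- Unpacking `a(x,…)/b(x,…) ∈ T` into a polynomial identity `φ(a)·s = φ(b)·g` in `k[t,y,z,w]`
with `s(0) ≠ 0`. [folklore] -/
theorem exists_eq_of_div_mem_Tn {A B : MvPolynomial (Fin (m + 3)) k} (hB : aeval (pt k m v) B ≠ 0)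
    (h : aeval (pt k m v) A / aeval (pt k m v) B ∈ Tn hv) :
    ∃ g s : MvPolynomial (Fin (m + 3)) k, constantCoeff s ≠ 0 ∧ chart k m A * s = chart k m B * g := by
  obtain ⟨g, s, hs, hgs⟩ := (mem_originLocalRing_iff hv).mp h
  refine ⟨g, s, hs, ?_⟩
  rw [aeval_pt, aeval_pt] at hgs
  rw [aeval_pt] at hB
  rw [div_eq_div_iff hB (aeval_ne_zero_of_constantCoeff_ne_zero hv hs), ← map_mul, ← map_mul] at hgs
  have := algebraicIndependent_iff_injective_aeval.mp hv hgs
  rw [this, mul_comm]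

/-- **Sally 1972, Theorem 4.4, for `R ⊂ T = R[x/(y²+z³)]_N` in dimension `n = m + 3`**: if
`p, q ∈ 𝔪_R` are linearly independent modulo `𝔪_R²` (part of a regular system of parameters),
then `p/q ∉ T`; so `T` contains no simple extension `R[p/q]_𝔭` of `R`.
[cite: Sally1972, Thm. 4.4, Cor. 4.5 and Ex. 4.6] -/
theorem div_not_mem_Tn {p q : L} (hp : p ∈ Rn hv) (hq : q ∈ Rn hv)
    (h : Sally1972.IndepModSq (Rn hv) ⟨p, hp⟩ ⟨q, hq⟩) : p / q ∉ Tn hv := by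
  have hxyz := algebraicIndependent_pt hv
  obtain ⟨hpm, hqm, hli⟩ := h
  obtain ⟨a₁, b₁, hb₁, rfl⟩ := (mem_originLocalRing_iff hxyz).mp hp
  obtain ⟨a₂, b₂, hb₂, rfl⟩ := (mem_originLocalRing_iff hxyz).mp hq
  have ha₁ : constantCoeff a₁ = 0 :=
    (div_mem_maximalIdeal_originLocalRing_iff hxyz a₁ b₁ hb₁ hp).mp hpm
  have ha₂ : constantCoeff a₂ = 0 :=
    (div_mem_maximalIdeal_originLocalRing_iff hxyz a₂ b₂ hb₂ hq).mp hqm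
  have hb₁0 := aeval_ne_zero_of_constantCoeff_ne_zero hxyz hb₁
  have hb₂0 := aeval_ne_zero_of_constantCoeff_ne_zero hxyz hb₂
  have h1 : (1 : Rn hv) ∉ maximalIdeal (Rn hv) := (maximalIdeal.isMaximal (Rn hv)).ne_top ∘
    fun h1 => Ideal.eq_top_of_isUnit_mem _ h1 isUnit_one
  set A := a₁ * b₂ with hA
  set B := b₁ * a₂ with hB
  have hcomb : ∀ c₁ c₂ : k,
      algebraMap k (Rn hv) c₁ * ⟨_, hp⟩ + algebraMap k (Rn hv) c₂ * ⟨_, hq⟩ =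
        ⟨aeval (pt k m v) (C c₁ * A + C c₂ * B) / aeval (pt k m v) (b₁ * b₂),
          (mem_originLocalRing_iff hxyz).mpr ⟨_, _, by simp [hb₁, hb₂], rfl⟩⟩ := by
    intro c₁ c₂
    apply Subtype.ext
    change algebraMap k L c₁ * (aeval (pt k m v) a₁ / aeval (pt k m v) b₁) +
        algebraMap k L c₂ * (aeval (pt k m v) a₂ / aeval (pt k m v) b₂) = _
    simp only [map_add, map_mul, algHom_C, hA, hB]
    field_simp
  have hsq : ∀ c₁ c₂ : k, C c₁ * A + C c₂ * B ∈ originIdeal k (m + 3) ^ 2 →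
      algebraMap k (Rn hv) c₁ * ⟨_, hp⟩ + algebraMap k (Rn hv) c₂ * ⟨_, hq⟩ ∈
        maximalIdeal (Rn hv) ^ 2 := by
    intro c₁ c₂ hmem
    rw [hcomb]
    exact div_mem_maximalIdeal_sq hxyz hmem (by simp [hb₁, hb₂])
  have hAB : IndepPair (lin A) (lin B) := by
    intro c₁ c₂ hc
    have hmem : C c₁ * A + C c₂ * B ∈ originIdeal k (m + 3) ^ 2 := by
      refine mem_originIdeal_sq (by simp [hA, hB, ha₁, ha₂]) fun i => ?_
      have := congrFun hc i
      simp only [Pi.add_apply, Pi.smul_apply, smul_eq_mul, Pi.zero_apply] at this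
      simp [this]
    have h' := hli _ _ (hsq _ _ hmem)
    constructor
    · by_contra hc₁
      apply h1
      have hu : IsUnit (algebraMap k (Rn hv) c₁) := (IsUnit.mk0 c₁ hc₁).map _
      exact (Ideal.eq_top_of_isUnit_mem _ h'.1 hu) ▸ Submodule.mem_top
    · by_contra hc₂
      apply h1
      have hu : IsUnit (algebraMap k (Rn hv) c₂) := (IsUnit.mk0 c₂ hc₂).map _
      exact (Ideal.eq_top_of_isUnit_mem _ h'.2 hu) ▸ Submodule.mem_top
  -- `q ≠ 0`, so `B(x,…) ≠ 0`
  have ha₂0 : aeval (pt k m v) a₂ ≠ 0 := by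
    intro h0
    have hq0 : (⟨aeval (pt k m v) a₂ / aeval (pt k m v) b₂, hq⟩ : Rn hv) = 0 := by
      apply Subtype.ext
      change aeval (pt k m v) a₂ / aeval (pt k m v) b₂ = 0
      rw [h0, zero_div]
    have := (hli 0 1 (by rw [hq0]; simp)).2
    exact h1 this
  have hBne : aeval (pt k m v) B ≠ 0 := by
    rw [hB, map_mul]; exact mul_ne_zero hb₁0 ha₂0
  intro hT
  have hT' : aeval (pt k m v) A / aeval (pt k m v) B ∈ Tn hv := by
    rw [hA, hB, map_mul, map_mul, ← div_div_div_eq]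
    · exact hT
  obtain ⟨g, s, hs, hgs⟩ := exists_eq_of_div_mem_Tn hv hBne hT'
  exact core m (by simp [hA, ha₁]) (by simp [hB, ha₂]) hAB hs hgs

/-! ### `R ≠ T`, and `R`, `T` have the same quotient field -/

/-- `t ∉ R`: `t = x/(y² + z³)` is not a fraction `a(x,…)/b(x,…)` with `b(0) ≠ 0` (test point
`(t, y, z, w) ↦ (ε, 0, 0, 0)` in `k[ε]`). [cite: Sally1972, Ex. 4.6] -/
theorem v_zero_not_mem_Rn : v 0 ∉ Rn hv := by
  have hxyz := algebraicIndependent_pt hv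
  intro h
  obtain ⟨a, b, hb, hab⟩ := (mem_originLocalRing_iff hxyz).mp h
  have hb' : constantCoeff (chart k m b) ≠ 0 := by rwa [← constantCoeff_chart k m b] at hb
  rw [aeval_pt, aeval_pt, eq_div_iff (aeval_ne_zero_of_constantCoeff_ne_zero hv hb'),
    ← aeval_X (R := k) v 0, ← map_mul] at hab
  have he := algebraicIndependent_iff_injective_aeval.mp hv hab
  -- the test point `(ε, 0, …, 0)`
  let θ : Fin (m + 3) → TrivSqZeroExt k k := fun i => if i = 0 then inr 1 else 0
  have hθ : (fun i => aeval θ (chartFun k m i)) = 0 := by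
    funext i
    unfold chartFun
    split_ifs with hi
    · simp [θ, cusp, map_add, map_pow, one_ne_zero_fin m, two_ne_zero_fin m]
    · simp [θ, hi]
  have := congrArg (fun q => aeval θ q) he
  simp only [map_mul, aeval_X, aeval_chart, hθ] at this
  rw [aeval_zero, aeval_zero] at this
  have h2 := congrArg snd this
  simp [θ, algebraMap_eq_inl'] at h2
  exact hb h2

/-- `R ≠ T`. [cite: Sally1972, Ex. 4.6] -/
theorem Rn_ne_Tn : Rn hv ≠ Tn hv := fun h =>
  v_zero_not_mem_Rn hv (h ▸ mem_originLocalRing_self hv 0)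

omit hv in
/-- Every polynomial in `t, y, z, w` becomes a polynomial in `x, y, z, w` after multiplication by a
power of `f = y² + z³`. [folklore] -/
theorem exists_mul_pow_eq_aeval_pt (g : MvPolynomial (Fin (m + 3)) k) :
    ∃ (r : ℕ) (G : MvPolynomial (Fin (m + 3)) k),
      aeval v g * aeval v (cusp k m) ^ r = aeval (pt k m v) G := by
  let S : Subalgebra k L :=
    { carrier := {w | ∃ (r : ℕ) (G : MvPolynomial (Fin (m + 3)) k),
        w * aeval v (cusp k m) ^ r = aeval (pt k m v) G}
      mul_mem' := by
        rintro w₁ w₂ ⟨n₁, G₁, h₁⟩ ⟨n₂, G₂, h₂⟩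
        refine ⟨n₁ + n₂, G₁ * G₂, ?_⟩
        rw [map_mul, ← h₁, ← h₂, pow_add]; ring
      add_mem' := by
        rintro w₁ w₂ ⟨n₁, G₁, h₁⟩ ⟨n₂, G₂, h₂⟩
        refine ⟨n₁ + n₂, G₁ * cusp k m ^ n₂ + G₂ * cusp k m ^ n₁, ?_⟩
        have hf : aeval (pt k m v) (cusp k m) = aeval v (cusp k m) := by rw [aeval_pt, chart_cusp]
        rw [map_add, map_mul, map_mul, map_pow, map_pow, hf, ← h₁, ← h₂, pow_add]; ring
      algebraMap_mem' := fun c => ⟨0, C c, by simp⟩ }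
  have hS : ∀ i, v i ∈ S := by
    intro i
    by_cases hi : i = 0
    · subst hi
      refine ⟨1, X 0, ?_⟩
      rw [aeval_X, pt_zero, pow_one, aeval_cusp]
    · refine ⟨0, X i, ?_⟩
      rw [aeval_X, pt_of_ne_zero hi, pow_zero, mul_one]
  have hle : Algebra.adjoin k (Set.range v) ≤ S := Algebra.adjoin_le (by rintro _ ⟨i, rfl⟩; exact hS i)
  have hg : aeval v g ∈ Algebra.adjoin k (Set.range v) := by
    rw [Algebra.adjoin_range_eq_range_aeval]; exact ⟨g, rfl⟩
  exact hle hg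

/-- **`R` and `T` have the same quotient field**: every element of `T` is a quotient of two elements
of `R`. [cite: Sally1972, Thm. 4.4] -/
theorem exists_div_eq_of_mem_Tn {q : L} (hq : q ∈ Tn hv) :
    ∃ p₁ ∈ Rn hv, ∃ p₂ ∈ Rn hv, p₂ ≠ 0 ∧ q = p₁ / p₂ := by
  have hxyz := algebraicIndependent_pt hv
  obtain ⟨g, s, hs, rfl⟩ := (mem_originLocalRing_iff hv).mp hq
  obtain ⟨n, G, hG⟩ := exists_mul_pow_eq_aeval_pt (v := v) g
  obtain ⟨n', S, hS⟩ := exists_mul_pow_eq_aeval_pt (v := v) s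
  have hf0 : aeval v (cusp k m) ≠ 0 := by
    intro h0
    exact cusp_ne_zero k m (algebraicIndependent_iff_injective_aeval.mp hv (by rw [h0, map_zero]))
  have hs0 : aeval v s ≠ 0 := aeval_ne_zero_of_constantCoeff_ne_zero hv hs
  refine ⟨aeval (pt k m v) G * aeval v (cusp k m) ^ n', ?_, aeval (pt k m v) S * aeval v (cusp k m) ^ n,
    ?_, ?_, ?_⟩
  · refine Subalgebra.mul_mem _ (aeval_mem_originLocalRing hxyz G) (Subalgebra.pow_mem _ ?_ _)
    rw [← chart_cusp, ← aeval_pt]; exact aeval_mem_originLocalRing hxyz _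
  · refine Subalgebra.mul_mem _ (aeval_mem_originLocalRing hxyz S) (Subalgebra.pow_mem _ ?_ _)
    rw [← chart_cusp, ← aeval_pt]; exact aeval_mem_originLocalRing hxyz _
  · rw [← hS]; exact mul_ne_zero (mul_ne_zero hs0 (pow_ne_zero _ hf0)) (pow_ne_zero _ hf0)
  · rw [← hG, ← hS, div_eq_div_iff hs0 (mul_ne_zero (mul_ne_zero hs0 (pow_ne_zero _ hf0))
      (pow_ne_zero _ hf0))]
    ring

/-- **`T` is not accessible from `R`** (Sally 1972, Ex. 4.6 in dimension `n = m + 3`: "`T` is not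
accessible from `R`"), for the tree's verbatim notion `IsStrictlyAccessible` (chains of strict simple
extensions `R[p/q]_𝔭`, `AccessibleInDim.lean`): a chain is either empty — but `R ≠ T` — or starts
with a simple extension `R[p/q]_𝔭 ⊆ T`, putting `p/q ∈ T` against `div_not_mem_Tn`.
[cite: Sally1972, Cor. 4.5 and Ex. 4.6] -/
theorem not_isStrictlyAccessible : ¬ IsStrictlyAccessible (Rn hv).toSubring (Tn hv).toSubring := by
  intro hacc
  rcases hacc.cases_head with hEq | ⟨R₁, h₁, hrest⟩
  · exact Rn_ne_Tn hv (Subalgebra.toSubring_injective hEq)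
  · obtain ⟨_, p, q, hpq, hmem⟩ := h₁.exists_div_mem
    have hpqT : (p : L) / (q : L) ∈ Tn hv := (IsStrictlyAccessible.le hrest) hmem
    exact div_not_mem_Tn hv p.2 q.2 hpq hpqT

end Rings

end Sally1972AllDim

/-! ## `¬ AccessibleInDim n` for every `n ≥ 3` -/

open _root_.MvPolynomial in
/-- **Sally 1972, Cor. 4.5 / Ex. 4.6 in every dimension `n > 2`**: `¬ AccessibleInDim n` for all
`n ≥ 3`. Over `k = ℚ` (lifted to the universe), with `K = k(t, y, z, w₄, …, wₙ)` and
`x = t(y² + z³)`, the `n`-dimensional regular local ring `T = k[t,y,z,w]_{(t,y,z,w)}` of `K`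
dominates `R = k[x,y,z,w]_{(x,y,z,w)}` (`QF(R) = K`) but is not accessible from `R`: the first
simple extension `R[p/q]_𝔭 ⊆ T` of a chain would put `p/q ∈ T`, contradicting
`Sally1972AllDim.div_not_mem_Tn` ("for dimension `n > 2` … every `n`-dimensional regular local ring
`R` has … regular local overrings which are not accessible from `R`", Sally p. 295; Ex. 4.6 is
stated for `M = (x, y, z, w₄, …, wₙ)`). [cite: Sally1972, Cor. 4.5 and Ex. 4.6] -/
theorem not_accessibleInDim_of_three_le {n : ℕ} (hn : 3 ≤ n) : ¬ AccessibleInDim.{u} n := by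
  obtain ⟨m, rfl⟩ := Nat.exists_eq_add_of_le' hn
  intro h
  let k : Type u := ULift.{u} ℚ
  let K : Type u := FractionRing (MvPolynomial (Fin (m + 3)) k)
  let v : Fin (m + 3) → K := fun i => algebraMap (MvPolynomial (Fin (m + 3)) k) K (X i)
  have haeval : ∀ p : MvPolynomial (Fin (m + 3)) k,
      aeval v p = algebraMap (MvPolynomial (Fin (m + 3)) k) K p := by
    intro p
    have hfun : (aeval v : MvPolynomial (Fin (m + 3)) k →ₐ[k] K) =
        IsScalarTower.toAlgHom k (MvPolynomial (Fin (m + 3)) k) K :=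
      MvPolynomial.algHom_ext fun i => by simp [v]
    exact congrArg (fun φ : MvPolynomial (Fin (m + 3)) k →ₐ[k] K => φ p) hfun
  have hv : AlgebraicIndependent k v := by
    intro p q hpq
    have hpq' : aeval v p = aeval v q := hpq
    rw [haeval, haeval] at hpq'
    exact IsFractionRing.injective (MvPolynomial (Fin (m + 3)) k) K hpq'
  -- `QF(R) = K`
  have hRK : IsLocalRingOf (Sally1972AllDim.Rn hv).toSubring := by
    refine ⟨Sally1972AllDim.instIsLocalRingSubtypeMemSubalgebraRn hv, fun w => ?_⟩
    obtain ⟨a, b, hb, rfl⟩ := IsFractionRing.div_surjective (A := MvPolynomial (Fin (m + 3)) k) w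
    have hb0 : algebraMap (MvPolynomial (Fin (m + 3)) k) K b ≠ 0 :=
      IsFractionRing.to_map_ne_zero_of_mem_nonZeroDivisors hb
    have haT : algebraMap (MvPolynomial (Fin (m + 3)) k) K a ∈ Sally1972AllDim.Tn hv := by
      rw [← haeval]; exact aeval_mem_originLocalRing hv a
    have hbT : algebraMap (MvPolynomial (Fin (m + 3)) k) K b ∈ Sally1972AllDim.Tn hv := by
      rw [← haeval]; exact aeval_mem_originLocalRing hv b
    obtain ⟨p₁, hp₁, p₂, hp₂, hp₂0, hpe⟩ := Sally1972AllDim.exists_div_eq_of_mem_Tn hv haT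
    obtain ⟨q₁, hq₁, q₂, hq₂, hq₂0, hqe⟩ := Sally1972AllDim.exists_div_eq_of_mem_Tn hv hbT
    have hq₁0 : q₁ ≠ 0 := by
      rintro rfl
      exact hb0 (by rw [hqe, zero_div])
    refine ⟨p₁ * q₂, Subalgebra.mul_mem _ hp₁ hq₂, p₂ * q₁, Subalgebra.mul_mem _ hp₂ hq₁,
      mul_ne_zero hp₂0 hq₁0, ?_⟩
    rw [hpe, hqe, div_div_div_eq]
  have hacc := h K (Sally1972AllDim.Rn hv).toSubring (Sally1972AllDim.Tn hv).toSubring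
    (Sally1972AllDim.isRegularLocalRing_Rn hv) (Sally1972AllDim.ringKrullDim_Rn hv) hRK
    (Sally1972AllDim.isRegularLocalRing_Tn hv) (Sally1972AllDim.ringKrullDim_Tn hv)
    (Sally1972AllDim.dominates hv)
  exact Sally1972AllDim.not_isStrictlyAccessible hv hacc

/-! ## Dimensions `≤ 1`, and the census row decided in every dimension -/

/-- **Dimension `≤ 1`** (degenerate cases, for completeness of the dimension-indexed statement):
a regular local ring `R` of `K` of dimension `≤ 1` with `QF(R) = K` is a field or a discrete
valuation ring of `K`, hence a valuation ring of `K`, so the only local ring of `K` dominating it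
birationally is `R` itself (accessible by the empty sequence). [folklore] -/
theorem accessibleInDim_of_le_one {n : ℕ} (hn : n ≤ 1) : AccessibleInDim.{u} n := by
  intro K _ R T hR hRdim hRK _ _ hdom
  haveI := hR
  haveI : IsPrincipalIdealRing R :=
    isPrincipalIdealRing_of_ringKrullDim_le_one (by rw [hRdim]; exact_mod_cast hn)
  haveI : ValuationRing R := ValuationRing.iff_local_bezout_domain.mpr ⟨inferInstance, inferInstance⟩
  -- `R` is a valuation ring of `K = QF(R)`
  have hmem : ∀ z : K, z ∈ R ∨ z⁻¹ ∈ R := by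
    intro z
    obtain ⟨a, ha, b, hb, hb0, rfl⟩ := hRK.2 z
    obtain ⟨c, hc⟩ := PreValuationRing.cond (⟨a, ha⟩ : R) ⟨b, hb⟩
    rcases hc with h | h
    · have h' : a * (c : K) = b := by
        have := congrArg Subtype.val h; simpa using this
      by_cases ha0 : a = 0
      · left; rw [ha0, zero_div]; exact R.zero_mem
      · right
        have : (a / b)⁻¹ = (c : K) := by
          rw [inv_div, ← h', mul_div_cancel_left₀ _ ha0]
        rw [this]; exact c.2
    · have h' : b * (c : K) = a := by
        have := congrArg Subtype.val h; simpa using this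
      left
      have : a / b = (c : K) := by
        rw [← h', mul_div_cancel_left₀ _ hb0]
      rw [this]; exact c.2
  -- hence `T ⊆ R` by domination
  have hTR : T ≤ R := by
    intro z hz
    rcases hmem z with h | h
    · exact h
    · by_cases hz0 : z = 0
      · rw [hz0]; exact R.zero_mem
      · have := hdom.2 z⁻¹ h (by rw [inv_inv]; exact hz)
        rwa [inv_inv] at this
  rw [← le_antisymm hdom.1 hTR]
  exact Relation.ReflTransGen.refl

/-- **Census row O2b decided in every dimension**: accessibility of birationally dominating
`n`-dimensional regular local over-rings by Sally's simple extensions (`=` local quadratic /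
monoidal transforms with regular-parameter centres: Zariski–Abhyankar factorization in Sally's
language) holds exactly for `n ≤ 2` — PROVED for `n ≤ 1` (valuation rings), `n = 2`
(Zariski–Abhyankar, `accessibleInDim_two`), REFUTED for every `n ≥ 3` (Sally 1972 / Shannon 1973,
`not_accessibleInDim_of_three_le`). [cite: Sally1972, Def. 4.1, Thm. 4.4, Cor. 4.5, Ex. 4.6]
[cite: Abhyankar1956Valuations, Thm. 3] [cite: Shannon1973] -/
theorem accessibleInDim_iff {n : ℕ} : AccessibleInDim.{u} n ↔ n ≤ 2 := by
  constructor
  · intro h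
    by_contra hn
    exact not_accessibleInDim_of_three_le (by omega) h
  · intro hn
    rcases Nat.lt_or_ge n 2 with h2 | h2
    · exact accessibleInDim_of_le_one (by omega)
    · obtain rfl : n = 2 := le_antisymm hn h2
      exact accessibleInDim_two

end Literature.Barriers.ResolutionOfSingularities

end
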